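import Summits.QuantumFields.YangMills.Theorems.TwistEaterVolumeQuadraticGrowth
import HarnessLib

/-!
# Separation of the twisted deficit off the tubes around the twist-eater orbits
# (layer (A) of the DIRECT Laplace road to ⟨stmt-QuantumFields-24204⟩ `VirialFluxGap.SharpTwistedLaplace`)

Helper module (free-hands work of width seat ym-line-sfw-p2-w2 g49, cell ym-idea-1).  The landed crux
✓⟨stmt-QuantumFields-24320⟩ `TwistEaterVolume.QuadraticGrowth` (`quadraticGrowth_proof`: for `L ≥ L₀`, `z ≠ 0` and
every ring history `P` with `F_z(P) ≤ (KL^q)⁻¹`, the squared chordal ring distance of `P` to the zero set of `F_z` is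
`≤ KL^q·F_z(P)`) is read contrapositively as the SEPARATION hypothesis `hout` of the quantitative Laplace theorems
(`QuantitativeLaplace.laplaceMethod_quantitative_orbit`, `…_sum_of_tubes`): OFF the tube `{dist² < ρ}` around the
zero set, the deficit has the floor `F_z ≥ min((KL^q)⁻¹, ρ/(KL^q))` — polynomial in `L` for `ρ = 1/poly(L)`.
Everything here is PROVED; no definitions, no named facts.

HONEST FRAMING: bookkeeping over a landed crux; ⟨24204⟩, ⟨24319⟩ and every rung stay OPEN; the Yang–Mills mass gap
(Clay) is NOT touched; no summit is proved by a line.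
-/

noncomputable section

open Set
open Literature.MathematicalPhysics.QuantumFieldTheory hiding SU2
open Summit.QuantumFields.YangMills.Theorems.FemtoTransferGap
open Summit.QuantumFields.YangMills.Theorems.VirialFluxGap.RingDeficit

namespace Summit.QuantumFields.YangMills.Theorems.QuantitativeLaplace

/-- ★ **The deficit floor off the tubes** (separation for the Laplace method, from ✓⟨24320⟩ `QuadraticGrowth`):
there are `K > 0`, `q ≥ 0`, `L₀` such that for `L ≥ L₀`, `z ≠ 0`, every `ρ > 0` and every ring history `P` whose
squared chordal ring distance to the zero set of `F_z` is at least `ρ`,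
`min ((KL^q)⁻¹) (ρ/(KL^q)) ≤ F_z(P)`. [folklore] -/
theorem ringDeficit_floor_off_tube :
    ∃ K : ℝ, 0 < K ∧ ∃ q : ℝ, 0 ≤ q ∧ ∃ L₀ : ℕ, ∀ (L : ℕ) [NeZero L], L₀ ≤ L →
      ∀ z : Fin 3 → Bool, z ≠ (fun _ => false) → ∀ ρ : ℝ, 0 < ρ →
      ∀ P : (Fin (2 * L - 1 + 1) → GaugeConfig 3 L SU2) × (Site 3 L → SU2),
        ρ ≤ sInf ((fun Q : (Fin (2 * L - 1 + 1) → GaugeConfig 3 L SU2) × (Site 3 L → SU2) =>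
            (∑ i : Fin (2 * L - 1 + 1), (6 * (L : ℝ) ^ 3 - timeCoupling su2Rep (P.1 i) (Q.1 i))) +
              ∑ x : Site 3 L, (2 - ((su2Rep (P.2 x * (Q.2 x)⁻¹)).trace).re)) ''
            {Q | ringDeficit L z Q = 0}) →
        min (K * (L : ℝ) ^ q)⁻¹ (ρ / (K * (L : ℝ) ^ q)) ≤ ringDeficit L z P := by
  obtain ⟨K, hK, q, hq, L₀, h⟩ := Summit.QuantumFields.YangMills.Theorems.TwistEaterVolume.quadraticGrowth_proof
  refine ⟨K, hK, q, hq, L₀, fun L _ hL z hz ρ hρ P hP => ?_⟩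
  have hKL : 0 < K * (L : ℝ) ^ q := by
    have : (0 : ℝ) < (L : ℝ) := by exact_mod_cast Nat.pos_of_ne_zero (NeZero.ne L)
    positivity
  by_cases hsmall : ringDeficit L z P ≤ (K * (L : ℝ) ^ q)⁻¹
  · -- inside the Łojasiewicz regime: `ρ ≤ dist² ≤ KL^q·F`
    have hdist := h L hL z hz P hsmall
    have : ρ / (K * (L : ℝ) ^ q) ≤ ringDeficit L z P := by
      rw [div_le_iff₀ hKL]
      calc ρ ≤ _ := hP
        _ ≤ K * (L : ℝ) ^ q * ringDeficit L z P := hdist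
        _ = ringDeficit L z P * (K * (L : ℝ) ^ q) := by ring
    exact (min_le_right _ _).trans this
  · exact (min_le_left _ _).trans (not_le.mp hsmall).le

end Summit.QuantumFields.YangMills.Theorems.QuantitativeLaplace
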